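import Literature.NumberTheory.Sieve.FGKMT2018DkBoxClasses
import Literature.NumberTheory.Sieve.FGKMT2018SingularSeriesSplitting
import HarnessLib

/-!
# FGKMT 2018 Theorem 6 / Maynard 2016 Prop. 9.1: the prefactor of the main term

Sources: J. Maynard, *Dense clusters of primes in subsets*, Compositio Math. 152 (2016) =
arXiv:1405.2593 [Maynard2016DenseClusters], proof of Proposition 9.1 pp. 19–20 («we see that
(9.4) is non-zero only for … in which case the two singular series cancel … giving the main term
`(B^k/φ(B)^k) 𝔖_B(𝓛) #𝒜(x) (log R)^k I_k(F)`»), choice of `y_r` (8.7) p. 15;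
K. Ford, B. Green, S. Konyagin, J. Maynard, T. Tao, *Long gaps between primes*, JAMS 31 (2018) =
arXiv:1412.5029v4 [FordGreenKonyaginMaynardTao2018], (7.8)–(7.9), Theorem 6 (i) p. 21.

PROVED here (no named facts): with `W = ∏_{p ≤ 2k², p ∤ B} p` (`wCut k B`),

* `coprime_wCut_self` (`(W, B) = 1`), `cast_mul_div_totient_mul`
  (`WB/φ(WB) = (W/φ(W)) (B/φ(B))`);
* **`mainTerm_prefactor_eq`** — for admissible non-degenerate `𝓛`:
  `(φ_ω(W)/W) · ((WB)^k/φ(WB)^k) · 𝔖_{WB}(𝓛) = (B/φ(B))^k 𝔖_B(𝓛)`, i.e. the local factor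
  `φ_ω(W)/W` produced by the `W`-cut (`abs_sum_sieveWt_sub_quadForm_le`) times the normalisation
  of `y_r` (`yVar_eq_mul_F`: `y_r = ((WB)^k/φ(WB)^k) 𝔖_{WB}(𝓛) F(…)`) is exactly the prefactor
  `bOverPhi B ^ k * singSeriesExcl L B` of `mainTermA` / `mainTermB` («the singular series
  cancel»); from `singSeriesExcl_eq_phiOmega_mul`.

## References
* J. Maynard, *Dense clusters of primes in subsets*, Compositio Math. 152 (2016), (8.7) and the
  proof of Prop. 9.1 [Maynard2016DenseClusters].
* K. Ford, B. Green, S. Konyagin, J. Maynard, T. Tao, *Long gaps between primes*, JAMS 31 (2018),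
  (7.8)–(7.9) [FordGreenKonyaginMaynardTao2018].
-/

noncomputable section

open Finset

namespace Literature.NumberTheory.Sieve.FGKMT2018

variable {k : ℕ}

/-- `(W, B) = 1`: every prime of `W = ∏_{p ≤ 2k², p ∤ B} p` fails to divide `B`.
[cite: FordGreenKonyaginMaynardTao2018, §7 p. 21 (definition of W)] -/
theorem coprime_wCut_self (k B : ℕ) : (wCut k B).Coprime B := by
  unfold wCut
  refine Nat.Coprime.prod_left fun p hp => ?_
  obtain ⟨-, hpp, hpB⟩ := Finset.mem_filter.1 hp
  exact (Nat.Prime.coprime_iff_not_dvd hpp).2 hpB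

/-- `WB/φ(WB) = (W/φ(W))·(B/φ(B))` for coprime `W, B`.
[cite: FordGreenKonyaginMaynardTao2018, (7.9) p. 21] -/
theorem cast_mul_div_totient_mul {W B : ℕ} (h : W.Coprime B) :
    ((W * B : ℕ) : ℝ) / (Nat.totient (W * B) : ℝ) =
      (W : ℝ) / (Nat.totient W : ℝ) * ((B : ℝ) / (Nat.totient B : ℝ)) := by
  rw [Nat.totient_mul h]; push_cast
  rw [mul_div_mul_comm]

/-- **«The singular series cancel»** [Maynard2016DenseClusters, proof of Prop. 9.1 pp. 19–20]:
for admissible non-degenerate `𝓛` and `W = ∏_{p ≤ 2k², p ∤ B} p`,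
`(φ_ω(W)/W) · ((WB)^k/φ(WB)^k · 𝔖_{WB}(𝓛)) = (B/φ(B))^k · 𝔖_B(𝓛)` — the prefactor of
`mainTermA`/`mainTermB`. [cite: Maynard2016DenseClusters, proof of Prop. 9.1 pp. 19–20, (8.7) p. 15; FordGreenKonyaginMaynardTao2018, (7.8)–(7.9) p. 21] -/
theorem mainTerm_prefactor_eq {L : Fin k → ℤ × ℤ} (hadm : FormsAdmissible L)
    (hnd : FormsNondegenerate L) (B : ℕ) :
    phiOmega L (wCut k B) / (wCut k B : ℝ) *
        (((wCut k B * B : ℕ) : ℝ) ^ k / (Nat.totient (wCut k B * B) : ℝ) ^ k *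
          singSeriesExcl L (wCut k B * B)) =
      bOverPhi B ^ k * singSeriesExcl L B := by
  have hcop := coprime_wCut_self k B
  have hsplit := singSeriesExcl_eq_phiOmega_mul hadm hnd (squarefree_wCut k B) hcop
  rw [hsplit, ← div_pow, cast_mul_div_totient_mul hcop, mul_pow]
  unfold bOverPhi
  ring

/-- The same identity read on `y_r` (`F = F_k`, `r ∈ [1,∞)^k`, `R ≥ 1`):
`(φ_ω(W)/W) · y_r = (B/φ(B))^k 𝔖_B(𝓛) · F_k(log r₁/log R, …)`.
[cite: Maynard2016DenseClusters, (8.7) p. 15 and proof of Prop. 9.1 pp. 19–20] -/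
theorem phiOmega_div_mul_yVar_eq {L : Fin k → ℤ × ℤ} (hadm : FormsAdmissible L)
    (hnd : FormsNondegenerate L) (B : ℕ) {R : ℝ} (hR : 1 ≤ R) (r : Fin k → ℕ) (hr : ∀ i, 1 ≤ r i) :
    phiOmega L (wCut k B) / (wCut k B : ℝ) * yVar L B R (MaynardDense.F k) r =
      bOverPhi B ^ k * singSeriesExcl L B * MaynardDense.F k (fun i => Real.log (r i) / Real.log R) := by
  rw [yVar_eq_mul_F L B hR r hr, ← mul_assoc, ← mainTerm_prefactor_eq hadm hnd B]

end Literature.NumberTheory.Sieve.FGKMT2018
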